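import Literature.AlgebraicGeometry.Resolution.LogRegularCompleteStructure
import HarnessLib

/-!
# The refined chart ring `A ⊗_{ℤ[P]} ℤ[ℕ^N]` of a log regular local ring (Kato 1994, (10.3))

`Literature/AlgebraicGeometry/Resolution/LogRegularRefinementChart.lean`. K. Kato, *Toric
singularities*, Amer. J. Math. 116 (1994), (9.9)/(10.3): for a chart `P → 𝒪_X` and a refinement
`P ⊆ Q ≅ ℕ^N` of fs monoids (a cone of a regular subdivision), the modified scheme is locally
`X′ = X ⊗_{ℤ[P]} ℤ[ℕ^N]`, i.e. the ring `B = A[T₁,…,T_N]/(φ(p) − T^{c(p)} : p ∈ P)` where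
`c : P → ℕ^N` is the inclusion; and (10.3) "`X′` is regular" at the point `𝔔 = (𝔪_A, T)` over the
closed point. This file sets up the ALGEBRA of this chart (no completion yet):

* `RefinementRing φ c P` — the ring `B`; `residueChar` — `B → A/𝔪_A`, `Tᵢ ↦ 0`;
  `closedPoint` — its kernel `𝔔`, a maximal ideal;
* `closedPoint_eq_span_X` — `𝔔` is generated by the `N` classes of `T₁, …, T_N` (because
  `𝔪_A = (φ(P ∖ 0))` and `φ(p) = T^{c p}` with `c p ≠ 0`); hence
  `spanFinrank_maximalIdeal_localization_le` — `emb.dim B_𝔔 ≤ N`;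
* `lift` — the universal property: a ring map `ρ_A : A → R′` and elements `tᵢ ∈ R′` with
  `ρ_A(φ p) = t^{c p}` induce `B → R′`; `isUnit_lift_of_not_mem` — elements outside `𝔔` become
  units when `R′` is local and `tᵢ ∈ 𝔪_{R′}`, so the map extends to `B_𝔔 → R′` (`liftLocalization`).

References: [Kato1994] K. Kato, Toric singularities, Amer. J. Math. 116 (1994), (9.9), (10.3).
-/

noncomputable section

open IsLocalRing MvPolynomial

namespace Literature.AlgebraicGeometry.Resolution

namespace LogRegularCompleteStructure

universe u v

variable {A : Type u} [CommRing A] {M N : ℕ}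

/-! ### The ring `B = A[T]/(φ(p) − T^{c p})` -/

/-- The relations `φ(p) − T^{c(p)}`, `p ∈ P`, of the refined chart. [cite: Kato1994, (10.3)] -/
def refinementRelations (φ : (Fin M →₀ ℕ) → A) (c : (Fin M →₀ ℕ) → (Fin N →₀ ℕ))
    (P : AddSubmonoid (Fin M →₀ ℕ)) : Set (MvPolynomial (Fin N) A) :=
  (fun p => MvPolynomial.C (φ p) - MvPolynomial.monomial (c p) 1) '' (P : Set (Fin M →₀ ℕ))

/-- The ideal of relations of the refined chart. [cite: Kato1994, (10.3)] -/
def refinementIdeal (φ : (Fin M →₀ ℕ) → A) (c : (Fin M →₀ ℕ) → (Fin N →₀ ℕ))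
    (P : AddSubmonoid (Fin M →₀ ℕ)) : Ideal (MvPolynomial (Fin N) A) :=
  Ideal.span (refinementRelations φ c P)

/-- **The refined chart ring** `B = A ⊗_{ℤ[P]} ℤ[ℕ^N] = A[T₁,…,T_N]/(φ(p) − T^{c(p)} : p ∈ P)`.
[cite: Kato1994, (10.3)] -/
abbrev RefinementRing (φ : (Fin M →₀ ℕ) → A) (c : (Fin M →₀ ℕ) → (Fin N →₀ ℕ))
    (P : AddSubmonoid (Fin M →₀ ℕ)) : Type u :=
  MvPolynomial (Fin N) A ⧸ refinementIdeal φ c P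

variable (φ : (Fin M →₀ ℕ) → A) (c : (Fin M →₀ ℕ) → (Fin N →₀ ℕ)) (P : AddSubmonoid (Fin M →₀ ℕ))

/-- The relation `φ(p) = T^{c p}` holds in `B`. [cite: Kato1994, (10.3)] -/
theorem mk_C_eq_mk_monomial {p : Fin M →₀ ℕ} (hp : p ∈ P) :
    Ideal.Quotient.mk (refinementIdeal φ c P) (MvPolynomial.C (φ p)) =
      Ideal.Quotient.mk (refinementIdeal φ c P) (MvPolynomial.monomial (c p) 1) := by
  rw [Ideal.Quotient.eq]
  exact Ideal.subset_span ⟨p, hp, rfl⟩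

/-! ### The universal property -/

/-- A monomial evaluates to the product of powers. [folklore] -/
private theorem eval₂Hom_monomial_one {R' : Type v} [CommRing R'] (ρA : A →+* R')
    (t : Fin N → R') (e : Fin N →₀ ℕ) :
    MvPolynomial.eval₂Hom ρA t (MvPolynomial.monomial e (1 : A)) = e.prod fun i n => t i ^ n := by
  rw [MvPolynomial.eval₂Hom_monomial, map_one, one_mul]

/-- **Universal property of the refined chart ring**: a ring map `ρ_A : A → R′` and elements
`tᵢ ∈ R′` with `ρ_A(φ p) = ∏ tᵢ^{(c p)ᵢ}` for `p ∈ P` induce `B → R′`. [cite: Kato1994, (10.3)] -/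
def lift {R' : Type v} [CommRing R'] (ρA : A →+* R') (t : Fin N → R')
    (h : ∀ p ∈ P, ρA (φ p) = (c p).prod fun i n => t i ^ n) : RefinementRing φ c P →+* R' :=
  Ideal.Quotient.lift (refinementIdeal φ c P) (MvPolynomial.eval₂Hom ρA t) (by
    intro f hf
    unfold refinementIdeal at hf
    refine Submodule.span_induction (p := fun f _ => MvPolynomial.eval₂Hom ρA t f = 0)
      ?_ (map_zero _) (fun x y _ _ hx hy => by rw [map_add, hx, hy, add_zero])
      (fun a x _ hx => by rw [smul_eq_mul, map_mul, hx, mul_zero]) hf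
    rintro _ ⟨p, hp, rfl⟩
    rw [map_sub, MvPolynomial.eval₂Hom_C, eval₂Hom_monomial_one, h p hp, sub_self])

/-- `lift` on constants. [cite: Kato1994, (10.3)] -/
@[simp]
theorem lift_mk_C {R' : Type v} [CommRing R'] (ρA : A →+* R') (t : Fin N → R')
    (h : ∀ p ∈ P, ρA (φ p) = (c p).prod fun i n => t i ^ n) (a : A) :
    lift φ c P ρA t h (Ideal.Quotient.mk _ (MvPolynomial.C a)) = ρA a := by
  unfold lift
  rw [Ideal.Quotient.lift_mk, MvPolynomial.eval₂Hom_C]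

/-- `lift` on the variables. [cite: Kato1994, (10.3)] -/
@[simp]
theorem lift_mk_X {R' : Type v} [CommRing R'] (ρA : A →+* R') (t : Fin N → R')
    (h : ∀ p ∈ P, ρA (φ p) = (c p).prod fun i n => t i ^ n) (i : Fin N) :
    lift φ c P ρA t h (Ideal.Quotient.mk _ (MvPolynomial.X i)) = t i := by
  unfold lift
  rw [Ideal.Quotient.lift_mk, MvPolynomial.eval₂Hom_X']

/-- `lift` on a general class. [cite: Kato1994, (10.3)] -/
theorem lift_mk {R' : Type v} [CommRing R'] (ρA : A →+* R') (t : Fin N → R')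
    (h : ∀ p ∈ P, ρA (φ p) = (c p).prod fun i n => t i ^ n) (f : MvPolynomial (Fin N) A) :
    lift φ c P ρA t h (Ideal.Quotient.mk _ f) = MvPolynomial.eval₂Hom ρA t f := by
  unfold lift
  rw [Ideal.Quotient.lift_mk]

/-! ### The closed point `𝔔 = (𝔪_A, T)` -/

variable [IsLocalRing A]

/-- In the residue field, a non-constant monomial evaluated at `T = 0` vanishes. [folklore] -/
private theorem prod_zero_pow_eq_zero {k : Type v} [CommRing k] {e : Fin N →₀ ℕ} (he : e ≠ 0) :
    (e.prod fun (_ : Fin N) (n : ℕ) => (0 : k) ^ n) = 0 := by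
  obtain ⟨i, hi⟩ := Finsupp.support_nonempty_iff.2 he
  exact Finset.prod_eq_zero hi (zero_pow (Finsupp.mem_support_iff.1 hi))

/-- **The residue character** `B → A/𝔪_A`, `a ↦ ā`, `Tᵢ ↦ 0` (well defined because `φ(p) ∈ 𝔪_A`
and `c p ≠ 0` for `p ≠ 0`). [cite: Kato1994, (10.3)] -/
def residueChar (hφ0 : φ 0 = 1) (hφm : ∀ p ∈ P, p ≠ 0 → φ p ∈ maximalIdeal A) (hc0 : c 0 = 0)
    (hc : ∀ p ∈ P, p ≠ 0 → c p ≠ 0) : RefinementRing φ c P →+* ResidueField A :=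
  lift φ c P (residue A) (fun _ => 0) (by
    intro p hp
    by_cases hp0 : p = 0
    · subst hp0
      rw [hφ0, map_one, hc0, Finsupp.prod_zero_index]
    · rw [prod_zero_pow_eq_zero (hc p hp hp0), (residue_eq_zero_iff _).2 (hφm p hp hp0)])

/-- **The closed point** `𝔔 = ker (B → A/𝔪_A)` of the refined chart over the closed point of `A`.
[cite: Kato1994, (10.3)] -/
def closedPoint (hφ0 : φ 0 = 1) (hφm : ∀ p ∈ P, p ≠ 0 → φ p ∈ maximalIdeal A) (hc0 : c 0 = 0)
    (hc : ∀ p ∈ P, p ≠ 0 → c p ≠ 0) : Ideal (RefinementRing φ c P) :=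
  RingHom.ker (residueChar φ c P hφ0 hφm hc0 hc)

variable {φ c P} (hφ0 : φ 0 = 1) (hφm : ∀ p ∈ P, p ≠ 0 → φ p ∈ maximalIdeal A) (hc0 : c 0 = 0)
  (hc : ∀ p ∈ P, p ≠ 0 → c p ≠ 0)

/-- The residue character is onto. [cite: Kato1994, (10.3)] -/
theorem residueChar_surjective : Function.Surjective (residueChar φ c P hφ0 hφm hc0 hc) := by
  intro x
  obtain ⟨a, rfl⟩ := residue_surjective x
  exact ⟨Ideal.Quotient.mk _ (MvPolynomial.C a), by unfold residueChar; rw [lift_mk_C]⟩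

/-- `𝔔` is a maximal ideal. [cite: Kato1994, (10.3)] -/
theorem isMaximal_closedPoint : (closedPoint φ c P hφ0 hφm hc0 hc).IsMaximal :=
  RingHom.ker_isMaximal_of_surjective _ (residueChar_surjective hφ0 hφm hc0 hc)

/-- The classes of the variables lie in `𝔔`. [cite: Kato1994, (10.3)] -/
theorem mk_X_mem_closedPoint (i : Fin N) :
    Ideal.Quotient.mk _ (MvPolynomial.X i) ∈ closedPoint φ c P hφ0 hφm hc0 hc := by
  unfold closedPoint residueChar
  rw [RingHom.mem_ker, lift_mk_X]

/-- The classes of `a ∈ 𝔪_A` lie in `𝔔`. [cite: Kato1994, (10.3)] -/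
theorem mk_C_mem_closedPoint {a : A} (ha : a ∈ maximalIdeal A) :
    Ideal.Quotient.mk _ (MvPolynomial.C a) ∈ closedPoint φ c P hφ0 hφm hc0 hc := by
  unfold closedPoint residueChar
  rw [RingHom.mem_ker, lift_mk_C]
  exact (residue_eq_zero_iff _).2 ha

omit [IsLocalRing A] in
/-- A polynomial with zero constant coefficient lies in `(T₁, …, T_N)`. [folklore] -/
private theorem mem_span_X_of_constantCoeff_eq_zero {f : MvPolynomial (Fin N) A}
    (hf : MvPolynomial.constantCoeff f = 0) :
    f ∈ Ideal.span (Set.range (MvPolynomial.X : Fin N → MvPolynomial (Fin N) A)) := by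
  rw [← Set.image_univ, MvPolynomial.mem_ideal_span_X_image]
  intro m hm
  by_contra hcon
  push Not at hcon
  have hm0 : m = 0 := by
    ext i
    simpa using hcon i (Set.mem_univ i)
  subst hm0
  rw [MvPolynomial.mem_support_iff] at hm
  exact hm hf

omit [IsLocalRing A] in
/-- A non-constant monomial lies in `(T₁, …, T_N)`. [folklore] -/
private theorem monomial_mem_span_X {e : Fin N →₀ ℕ} (he : e ≠ 0) (a : A) :
    MvPolynomial.monomial e a ∈
      Ideal.span (Set.range (MvPolynomial.X : Fin N → MvPolynomial (Fin N) A)) := by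
  refine mem_span_X_of_constantCoeff_eq_zero ?_
  rw [MvPolynomial.constantCoeff_monomial, if_neg he]

/-- **`𝔔 = (T₁, …, T_N)`**: if `𝔪_A` is generated by `φ(P ∖ 0)` then the closed point of the
refined chart is generated by the classes of the variables (as `φ(p) = T^{c p}` with `c p ≠ 0`).
[cite: Kato1994, (10.3)] -/
theorem closedPoint_eq_span_X (hgen : maximalIdeal A ≤ Ideal.span (φ '' {p | p ∈ P ∧ p ≠ 0})) :
    closedPoint φ c P hφ0 hφm hc0 hc =
      Ideal.span (Set.range fun i : Fin N =>
        Ideal.Quotient.mk (refinementIdeal φ c P) (MvPolynomial.X i)) := by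
  classical
  refine le_antisymm ?_ ?_
  · intro b hb
    obtain ⟨f, rfl⟩ := Ideal.Quotient.mk_surjective b
    -- the constant coefficient of `f` lies in `𝔪_A`
    have hb' : residue A (MvPolynomial.constantCoeff f) = 0 := by
      unfold closedPoint residueChar at hb
      rw [RingHom.mem_ker, lift_mk] at hb
      rwa [MvPolynomial.eval₂Hom_zero'_apply] at hb
    rw [residue_eq_zero_iff] at hb'
    -- the target ideal, pulled back to `A[T]`, contains `(T)` and `C(𝔪_A)`
    set J : Ideal (RefinementRing φ c P) := Ideal.span (Set.range fun i : Fin N =>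
      Ideal.Quotient.mk (refinementIdeal φ c P) (MvPolynomial.X i)) with hJ
    have hXJ : Ideal.span (Set.range (MvPolynomial.X : Fin N → MvPolynomial (Fin N) A)) ≤
        J.comap (Ideal.Quotient.mk (refinementIdeal φ c P)) := by
      rw [Ideal.span_le]
      rintro _ ⟨i, rfl⟩
      exact Ideal.mem_comap.2 (Ideal.subset_span ⟨i, rfl⟩)
    have hCJ : ∀ a ∈ maximalIdeal A, MvPolynomial.C a ∈
        J.comap (Ideal.Quotient.mk (refinementIdeal φ c P)) := by
      intro a ha
      have ha' := hgen ha
      refine Submodule.span_induction (p := fun a _ => MvPolynomial.C a ∈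
          J.comap (Ideal.Quotient.mk (refinementIdeal φ c P))) ?_ ?_ ?_ ?_ ha'
      · rintro _ ⟨p, ⟨hpP, hp0⟩, rfl⟩
        rw [Ideal.mem_comap, mk_C_eq_mk_monomial φ c P hpP, ← Ideal.mem_comap]
        exact hXJ (monomial_mem_span_X (hc p hpP hp0) 1)
      · rw [map_zero]; exact Ideal.zero_mem _
      · intro x y _ _ hx hy
        rw [map_add]; exact Ideal.add_mem _ hx hy
      · intro r x _ hx
        rw [smul_eq_mul, map_mul]; exact Ideal.mul_mem_left _ _ hx
    have hf : f = MvPolynomial.C (MvPolynomial.constantCoeff f) +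
        (f - MvPolynomial.C (MvPolynomial.constantCoeff f)) := by ring
    rw [← Ideal.mem_comap, hf]
    refine Ideal.add_mem _ (hCJ _ hb') (hXJ (mem_span_X_of_constantCoeff_eq_zero ?_))
    rw [map_sub, MvPolynomial.constantCoeff_C, sub_self]
  · rw [Ideal.span_le]
    rintro _ ⟨i, rfl⟩
    exact mk_X_mem_closedPoint hφ0 hφm hc0 hc i

/-- **Embedding dimension of the refined chart**: `𝔪_{B_𝔔}` is generated by the `N` classes of
`T₁, …, T_N`, so `emb.dim B_𝔔 ≤ N`. [cite: Kato1994, (10.3)] -/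
theorem spanFinrank_maximalIdeal_localization_le
    (hgen : maximalIdeal A ≤ Ideal.span (φ '' {p | p ∈ P ∧ p ≠ 0})) :
    letI := isMaximal_closedPoint hφ0 hφm hc0 hc
    (maximalIdeal (Localization.AtPrime (closedPoint φ c P hφ0 hφm hc0 hc))).spanFinrank ≤ N := by
  classical
  letI := isMaximal_closedPoint hφ0 hφm hc0 hc
  let y : Fin N → Localization.AtPrime (closedPoint φ c P hφ0 hφm hc0 hc) := fun i =>
    algebraMap (RefinementRing φ c P) (Localization.AtPrime (closedPoint φ c P hφ0 hφm hc0 hc))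
      (Ideal.Quotient.mk (refinementIdeal φ c P) (MvPolynomial.X i))
  have hmax : maximalIdeal (Localization.AtPrime (closedPoint φ c P hφ0 hφm hc0 hc)) =
      Ideal.span (Set.range y) := by
    rw [← Localization.AtPrime.map_eq_maximalIdeal]
    have h1 := congrArg (Ideal.map (algebraMap (RefinementRing φ c P)
      (Localization.AtPrime (closedPoint φ c P hφ0 hφm hc0 hc))))
      (closedPoint_eq_span_X hφ0 hφm hc0 hc hgen)
    rw [h1, Ideal.map_span, ← Set.range_comp]
    rfl
  rw [hmax]
  have hfin : (Set.range y).Finite := Set.finite_range y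
  refine (Submodule.spanFinrank_span_le_ncard_of_finite hfin).trans ?_
  rw [← Set.image_univ, ← Finset.coe_univ, ← Finset.coe_image, Set.ncard_coe_finset]
  exact (Finset.card_image_le).trans (by rw [Finset.card_univ, Fintype.card_fin])

/-! ### Extension to the local ring `B_𝔔` -/

/-- If `R′` is local and the `tᵢ` lie in `𝔪_{R′}`, the induced map `B → R′` pulls `𝔪_{R′}` back to
`𝔔` (given `𝔪_A = (φ(P ∖ 0))`, so that `𝔔 = (T)`). [cite: Kato1994, (10.3)] -/
theorem comap_maximalIdeal_lift {R' : Type v} [CommRing R'] [IsLocalRing R'] (ρA : A →+* R')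
    (t : Fin N → R') (h : ∀ p ∈ P, ρA (φ p) = (c p).prod fun i n => t i ^ n)
    (ht : ∀ i, t i ∈ maximalIdeal R')
    (hgen : maximalIdeal A ≤ Ideal.span (φ '' {p | p ∈ P ∧ p ≠ 0})) :
    (maximalIdeal R').comap (lift φ c P ρA t h) = closedPoint φ c P hφ0 hφm hc0 hc := by
  haveI := isMaximal_closedPoint hφ0 hφm hc0 hc
  have hle : closedPoint φ c P hφ0 hφm hc0 hc ≤ (maximalIdeal R').comap (lift φ c P ρA t h) := by
    rw [closedPoint_eq_span_X hφ0 hφm hc0 hc hgen, Ideal.span_le]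
    rintro _ ⟨i, rfl⟩
    rw [SetLike.mem_coe, Ideal.mem_comap, lift_mk_X]
    exact ht i
  exact (Ideal.IsMaximal.eq_of_le inferInstance (Ideal.IsPrime.ne_top inferInstance) hle).symm

/-- Elements outside `𝔔` map to units of the local ring `R′`. [cite: Kato1994, (10.3)] -/
theorem isUnit_lift_of_not_mem {R' : Type v} [CommRing R'] [IsLocalRing R'] (ρA : A →+* R')
    (t : Fin N → R') (h : ∀ p ∈ P, ρA (φ p) = (c p).prod fun i n => t i ^ n)
    (ht : ∀ i, t i ∈ maximalIdeal R')
    (hgen : maximalIdeal A ≤ Ideal.span (φ '' {p | p ∈ P ∧ p ≠ 0}))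
    {s : RefinementRing φ c P} (hs : s ∉ closedPoint φ c P hφ0 hφm hc0 hc) :
    IsUnit (lift φ c P ρA t h s) := by
  rw [← comap_maximalIdeal_lift hφ0 hφm hc0 hc ρA t h ht hgen, Ideal.mem_comap] at hs
  by_contra hu
  exact hs ((mem_maximalIdeal _).2 (mem_nonunits_iff.2 hu))

/-- **The map `B_𝔔 → R′`** induced by `ρ_A` and `t` (localisation of `lift`).
[cite: Kato1994, (10.3)] -/
def liftLocalization {R' : Type v} [CommRing R'] [IsLocalRing R'] (ρA : A →+* R')
    (t : Fin N → R') (h : ∀ p ∈ P, ρA (φ p) = (c p).prod fun i n => t i ^ n)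
    (ht : ∀ i, t i ∈ maximalIdeal R')
    (hgen : maximalIdeal A ≤ Ideal.span (φ '' {p | p ∈ P ∧ p ≠ 0})) :
    letI := isMaximal_closedPoint hφ0 hφm hc0 hc
    Localization.AtPrime (closedPoint φ c P hφ0 hφm hc0 hc) →+* R' :=
  letI := isMaximal_closedPoint hφ0 hφm hc0 hc
  IsLocalization.lift (M := (closedPoint φ c P hφ0 hφm hc0 hc).primeCompl)
    (S := Localization.AtPrime (closedPoint φ c P hφ0 hφm hc0 hc))
    (g := lift φ c P ρA t h)
    (fun s => isUnit_lift_of_not_mem hφ0 hφm hc0 hc ρA t h ht hgen s.2)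

/-- `liftLocalization` extends `lift`. [cite: Kato1994, (10.3)] -/
theorem liftLocalization_algebraMap {R' : Type v} [CommRing R'] [IsLocalRing R'] (ρA : A →+* R')
    (t : Fin N → R') (h : ∀ p ∈ P, ρA (φ p) = (c p).prod fun i n => t i ^ n)
    (ht : ∀ i, t i ∈ maximalIdeal R')
    (hgen : maximalIdeal A ≤ Ideal.span (φ '' {p | p ∈ P ∧ p ≠ 0})) (b : RefinementRing φ c P) :
    letI := isMaximal_closedPoint hφ0 hφm hc0 hc
    liftLocalization hφ0 hφm hc0 hc ρA t h ht hgen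
      (algebraMap (RefinementRing φ c P) (Localization.AtPrime (closedPoint φ c P hφ0 hφm hc0 hc)) b) =
      lift φ c P ρA t h b := by
  letI := isMaximal_closedPoint hφ0 hφm hc0 hc
  unfold liftLocalization
  exact IsLocalization.lift_eq (M := (closedPoint φ c P hφ0 hφm hc0 hc).primeCompl)
    (S := Localization.AtPrime (closedPoint φ c P hφ0 hφm hc0 hc)) _ b

/-- `liftLocalization` sends `𝔪_{B_𝔔}` into `𝔪_{R′}`. [cite: Kato1994, (10.3)] -/
theorem map_maximalIdeal_liftLocalization_le {R' : Type v} [CommRing R'] [IsLocalRing R']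
    (ρA : A →+* R') (t : Fin N → R') (h : ∀ p ∈ P, ρA (φ p) = (c p).prod fun i n => t i ^ n)
    (ht : ∀ i, t i ∈ maximalIdeal R')
    (hgen : maximalIdeal A ≤ Ideal.span (φ '' {p | p ∈ P ∧ p ≠ 0})) :
    letI := isMaximal_closedPoint hφ0 hφm hc0 hc
    (maximalIdeal (Localization.AtPrime (closedPoint φ c P hφ0 hφm hc0 hc))).map
      (liftLocalization hφ0 hφm hc0 hc ρA t h ht hgen) ≤ maximalIdeal R' := by
  letI := isMaximal_closedPoint hφ0 hφm hc0 hc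
  rw [← Localization.AtPrime.map_eq_maximalIdeal, Ideal.map_map, Ideal.map_le_iff_le_comap]
  intro b hb
  rw [Ideal.mem_comap, RingHom.comp_apply, liftLocalization_algebraMap]
  rw [← comap_maximalIdeal_lift hφ0 hφm hc0 hc ρA t h ht hgen, Ideal.mem_comap] at hb
  exact hb

end LogRegularCompleteStructure

end Literature.AlgebraicGeometry.Resolution
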